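import Summits.QuantumFields.YangMills.Theorems.BalabanUVNodesN15KingModelFullPropagatorMixedHolderNearField

/-!
# BalabanUVNodes ∕ N15 — THE KING-MODEL RUNG, CURVED EDITION (PART Ψ-c): [B9] (3.45) AT `U ≡ 1` — THE HÖLDER NORM OF THE MIXED OBJECT
# `∇_{μ′}A₀⁻¹∇*_μλ` FOR KING'S FULL `A = 0` PROPAGATOR: `(|x − x′|∕N)^{−α}·|F(x′) − F(x)| ≤ C(α)·H_α·e^{−δ·dist({B(x), B(x′)}, supp λ)}`,
# `F(x) = N·((A₀⁻¹∇*_μλ)(x + e_μ′) − (A₀⁻¹∇*_μλ)(x))`, for every α-HÖLDER source (`0 < α < 1`), UNIFORMLY in `K`, the volume and the mass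
# (Track A, DAG node N15 = NE2; FAN-OUT v1.1 §N15 s3 «KING-MODEL RUNG … + the one-line statement of what the curved case adds»)

HONEST FRAMING.  Count-neutral kernel bookkeeping (cell `pub-ymgap`, seat `pub-ymgap-dag-n15-e` g10; `--supports stmt-QuantumFields-20544 --as helper` = K3⁷
`SpineGivenEndpointR13SepCoPH`, WORDS-143).  TEMPLATE LITERATURE, `A = 0`: C. King's scalar U(1)-Higgs MODEL on finite tori ([King1986] (2.13) p. 653,
Prop. 3.7 (3.63)∕(3.65) p. 663 with `|a| = |b| = 1`), NOT Bałaban's covariant objects.  [Balaban1985BackgroundPropagators] Thm 3.1 p. 398 prints (3.45):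
«`‖ζ∇_UG(U)∇*_Uλ‖_α ≤ B′₀(ε, α)(L^jη)^{−α}(‖ζ‖^ξ_α + |ζ|)e^{−δ₀d(y, y′)}(‖λ‖_{α+ε} + |λ|)` for `0 < ε`, `0 ≤ α < 1`, `supp λ ⊂ Δ̃(y′)`» — the HÖLDER-NORM entry of
Theorem 3.1, the last of its sup ∕ Hölder entries not yet decided at `U ≡ 1` for King's full `A = 0` propagator `A₀⁻¹ = G_K(T_ε, 0)` (parts U-ii∕U-b∕W-b: (3.43); V-b∕V-c:
(3.44); X: (3.46)–(3.47)).  THIS FILE decides it, in the MODEL, by a Calderón–Zygmund argument on the torus; the statement proved is in fact the SHARP exponent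
bookkeeping `C^α → C^α` (no `ε`-loss), from which the printed shape (`β`-norm by the `(β + ε)`-modulus) follows (§3).  NOT the printed proposition (covariant
`G(U)` over `Reg335`, multiscale carrier, cut-offs `ζ`); NE2⁺ is NOT PRINTED and not proved; NOT a node discharge; nothing continuum ∕ ℝ⁴ ∕ OS ∕ mass-gap ∕ Clay.
0 `sorry`, 0 `def`, standard axioms.

THE ARGUMENT.  `F(x) = Σ_y c·DD(y, x)·λ(y)`, `c = N^{−(d+1)}` (V-b `inv_deriv_adjDeriv_eq_sum`), `Σ_y DD(y, x) = 0` (V-b `sum_mixedKernel_eq_zero`).  With `ρ = |x − x′| ≥ 1`,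
`R = 2ρ + 1` and the Lipschitz radial cut-off `χ(y) = χ_R(|y − x|)` of part Ψ-b, the two cancellations give the EXACT four-term split (Ψ-b `mixedKernel_holder_split`)
`F(x′) − F(x) = Σ cDD(y,x′)χ(λ(y) − λ(x′)) − Σ cDD(y,x)χ(λ(y) − λ(x)) + Σ c[DD(y,x′) − DD(y,x)](1 − χ)(λ(y) − λ(x)) + (λ(x′) − λ(x))·Σ cDD(y,x′)χ`.
The two NEAR sums are `≤ C·H·(ρ∕N)^α` by Ψ-b `mixedKernel_nearField_le` (radii `7ρ`, `6ρ`); the FAR sum is `≤ C·H·(ρ∕N)^α` by §1 `mixedKernel_farField_le`: the kernel's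
Hölder quotient at an exponent `s = (1 + α)∕2 > α` (Ψ-a `fullPropDD_holder_powerLaw_decay_unif_snd`: `|ΔDD| ≲ (ρ∕N)^s(N∕m)^{d+1+s}`, `m ≥ r∕2` for `r = |y − x| > 2ρ`)
against `H(r∕N)^α` leaves `ρ^sN^{−α}·Σ_{r > 2ρ} r^{−(d+1)−(s−α)} ≲ ρ^sN^{−α}ρ^{−(s−α)}` (Ψ-a `powerSum_tail_le_tdistT`); the BOUNDARY term is `≤ H(ρ∕N)^α·C` by Ψ-b
`mixedKernel_cutoffSum_le`.  The decay factor `e^{−δD}`, `D ≤ dist({B(x), B(x′)}, supp λ)`, rides on every kernel bound (a term with `λ(y) = 0 ≠ λ(x)` forces `D ≤ 0`).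
* §1 `far_scale_algebra`, ★ `mixedKernel_farField_le`;
* §2 ★★★ **`fullPropMixedOp_holderNorm_le`** — `d ≥ 1`, `0 < α < 1`: `∃ C δ > 0 ∀ K ≥ 1 ∀ N = L^K ∀ cube 2L^e ∀ 0 < m² ≤ m₀² ∀ μ μ′ ∀ λ, H ≥ 0` with
  `|λ(y) − λ(y′)| ≤ H(|y − y′|∕N)^α` `∀ x x′ ∀ D` with `D ≤ |B(x) − B(y)|` and `D ≤ |B(x′) − B(y)|` on `supp λ`:
  `(|x − x′|∕N)^{−α}·|F(x′) − F(x)| ≤ C·H·e^{−δD}` — `∇A₀⁻¹∇*` maps `C^α → C^α` at `U ≡ 1`, uniformly in `K`, the volume and the mass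
  (the printed `β`-by-`(β + ε)` bookkeeping and the four-entry package of Theorem 3.1 at `U ≡ 1` are the sequel `…B9Thm31HolderAtTrivialU`).
WHAT THE CURVED CASE ADDS (one line): (3.45) itself — the same for `∇_UG(U)∇*_U` uniformly over `Reg335`, multiscale sites and cut-offs `ζ`, analyticity in `U` (Thm 3.4).
HONEST SCOPE.  (i) `A = 0`, periodic b.c., odd `L ≥ 3`, cubes `2L^e`, `K ≥ 1`, `0 < m² ≤ m₀²`, `d ≥ 1`; (ii) King's spelling of `A₀`, forward η-differences, lattice
units of level `K`, sup torus distance; (iii) GLOBAL Hölder modulus of `λ` (no `|λ|` term, no cut-off `ζ` — `ζ ≡ 1`, as in parts V-b∕V-c∕W-b); (iv) `0 < α < 1`;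
(v) not Bałaban's `G(U)`; not a discharge.
Locators: [Balaban1985BackgroundPropagators] Thm 3.1 (3.39)–(3.41) p. 397, (3.45) p. 398; [King1986] (2.13) p. 653, (3.62), Prop. 3.7 (3.63)∕(3.65) p. 663;
[Balaban1983RegularityDecay] Theorem (1.10) p. 573.
-/

noncomputable section

namespace Summit.QuantumFields.YangMills.BalabanUVNodes.N15KingModelRung.Curved

open Real Finset Matrix
open Literature.MathematicalPhysics.QuantumFieldTheory.Balaban1983to89.B5Prop11Plancherel (Tor fine unitVec)
open Literature.MathematicalPhysics.QuantumFieldTheory.King1986 (aK aK_pos)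
open Literature.MathematicalPhysics.QuantumFieldTheory.King1986.Torus (fineOp constrainedProp blockOf tdistT tdistT_nonneg tdistT_symm tdistT_self
  tdistT_triangle)

variable {d : ℕ} (L : ℕ) [NeZero L]

/-! ## §1 The far field -/

omit [NeZero L] in
/-- The scale algebra of the far field: `N^{−n}·(ρ∕N)^s·((2N∕r)^n(2N∕r)^s)·(r∕N)^α = 2^n·2^s·ρ^s·N^{−α}·r^{−(s−α)−n}` (`N, r, ρ > 0`). [folklore] -/
theorem far_scale_algebra {N r ρ s α : ℝ} (hN : 0 < N) (hr : 0 < r) (hρ : 0 < ρ) (n : ℕ) :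
    (N ^ n)⁻¹ * (ρ / N) ^ s * ((2 * N / r) ^ n * (2 * N / r) ^ s) * (r / N) ^ α
      = (2 : ℝ) ^ n * (2 : ℝ) ^ s * ρ ^ s * N ^ (-α) * r ^ (-(s - α) - n) := by
  have e1 : r ^ (-(s - α) - (n : ℝ)) = r ^ α / (r ^ s * r ^ n) := by
    rw [show -(s - α) - (n : ℝ) = α - (s + n) by ring, Real.rpow_sub hr, Real.rpow_add hr, Real.rpow_natCast]
  rw [e1, Real.rpow_neg hN.le, Real.div_rpow hρ.le hN.le, Real.div_rpow (by positivity) hr.le, Real.mul_rpow (by norm_num) hN.le,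
    Real.div_rpow hr.le hN.le, div_pow, mul_pow]
  have hNs : 0 < N ^ s := Real.rpow_pos_of_pos hN s
  have hrs : 0 < r ^ s := Real.rpow_pos_of_pos hr s
  have hNa : 0 < N ^ α := Real.rpow_pos_of_pos hN α
  field_simp
set_option maxHeartbeats 400000 in
/-- ★ **THE FAR FIELD**: for odd `L ≥ 3`, `a > 0`, `m₀² ≥ 0` and `0 < α < 1` there are `C, δ > 0` such that for EVERY `K ≥ 1` (`N = L^K`), cube `2L^e`, mass
`0 < m² ≤ m₀²`, directions `μ, ν`, every source `λ` with `|λ(y) − λ(y′)| ≤ H·(|y − y′|∕N)^α` (`H ≥ 0`), all `x ≠ x′` (`ρ = |x − x′|`), weights `0 ≤ w ≤ 1` with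
`w(y) = 0` whenever `|y − x| ≤ 2ρ`, and every `D` with `D ≤ |B(x) − B(y)|` and `D ≤ |B(x′) − B(y)|` whenever `λ(y) ≠ 0`:
`|Σ_y N^{−(d+1)}·(DD(y, x′) − DD(y, x))·w(y)·(λ(y) − λ(x))| ≤ C·H·(ρ∕N)^α·exp(−δD)` — on `|y − x| = r > 2ρ` one has `m = min(|y − x|, |y − x′|) ≥ r∕2`, the kernel's
Hölder quotient at the exponent `s = (1 + α)∕2` (part Ψ-a) gives `N^{−(d+1)}|ΔDD| ≤ C(ρ∕N)^s·2^{d+1+s}(r∕N)^{−(d+1)}(N∕r)^s·e^{−δD}`, the source pays `H(r∕N)^α`, and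
the tail `Σ_{r > 2ρ} r^{−(d+1)−(s−α)} ≤ C_t(2ρ)^{−(s−α)}` (part Ψ-a `powerSum_tail_le_tdistT`) returns `ρ^{s−(s−α)}N^{−α} = (ρ∕N)^α`.
[cite: King1986, (3.62) p.663, Prop. 3.7 (3.65) p.663; Balaban1985BackgroundPropagators, Thm 3.1 (3.45) p.398] -/
theorem mixedKernel_farField_le (hLodd : Odd L) (hL : 2 ≤ L) {a : ℝ} (ha : 0 < a) {m0sq : ℝ} (hm0 : 0 ≤ m0sq)
    {α : ℝ} (hα0 : 0 < α) (hα1 : α < 1) :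
    ∃ C δ : ℝ, 0 < C ∧ 0 < δ ∧ ∀ (K : ℕ), 1 ≤ K → ∀ (N : ℕ) [NeZero N], N = L ^ K →
      ∀ (e : ℕ) (M : Fin (d + 1) → ℕ) [∀ μ, NeZero (M μ)], (∀ μ, M μ = 2 * L ^ e) →
      ∀ (msq : ℝ), 0 < msq → msq ≤ m0sq → ∀ (μ ν : Fin (d + 1)) (lam : Tor (fine N M) → ℝ) (H : ℝ),
        0 ≤ H → (∀ y y', |lam y - lam y'| ≤ H * (tdistT (fine N M) y y' / (N : ℝ)) ^ α) →
        ∀ (x x' : Tor (fine N M)), x ≠ x' → ∀ (w : Tor (fine N M) → ℝ), (∀ y, 0 ≤ w y) → (∀ y, w y ≤ 1) →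
        (∀ y, tdistT (fine N M) x y ≤ 2 * tdistT (fine N M) x x' → w y = 0) →
        ∀ (D : ℝ), (∀ y, lam y ≠ 0 → D ≤ tdistT M (blockOf N M x) (blockOf N M y) ∧ D ≤ tdistT M (blockOf N M x') (blockOf N M y)) →
        |∑ y, ((N : ℝ) ^ (d + 1))⁻¹
            * (((N : ℝ) * ((N : ℝ) * (constrainedProp N M (aK a L K) (((N : ℕ) : ℝ) ^ 2) msq (y + unitVec (fine N M) μ) (x' + unitVec (fine N M) ν)
                - constrainedProp N M (aK a L K) (((N : ℕ) : ℝ) ^ 2) msq y (x' + unitVec (fine N M) ν))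
              - (N : ℝ) * (constrainedProp N M (aK a L K) (((N : ℕ) : ℝ) ^ 2) msq (y + unitVec (fine N M) μ) x'
                - constrainedProp N M (aK a L K) (((N : ℕ) : ℝ) ^ 2) msq y x')))
             - ((N : ℝ) * ((N : ℝ) * (constrainedProp N M (aK a L K) (((N : ℕ) : ℝ) ^ 2) msq (y + unitVec (fine N M) μ) (x + unitVec (fine N M) ν)
                - constrainedProp N M (aK a L K) (((N : ℕ) : ℝ) ^ 2) msq y (x + unitVec (fine N M) ν))
              - (N : ℝ) * (constrainedProp N M (aK a L K) (((N : ℕ) : ℝ) ^ 2) msq (y + unitVec (fine N M) μ) x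
                - constrainedProp N M (aK a L K) (((N : ℕ) : ℝ) ^ 2) msq y x))))
            * w y * (lam y - lam x)|
          ≤ C * H * (tdistT (fine N M) x x' / (N : ℝ)) ^ α * Real.exp (-(δ * D)) := by
  -- the kernel exponent `s ∈ (α, 1)` and the tail exponent `t = s − α > 0`
  set s : ℝ := (1 + α) / 2 with hsdef
  have hs0 : 0 < s := by rw [hsdef]; linarith
  have hs1 : s < 1 := by rw [hsdef]; linarith
  have hsα : α < s := by rw [hsdef]; linarith
  set t : ℝ := s - α with htdef
  have ht0 : 0 < t := by rw [htdef]; linarith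
  obtain ⟨C₀, δ, hC₀, hδ, HΔ⟩ := fullPropDD_holder_powerLaw_decay_unif_snd (d := d) L hLodd hL ha hm0 hs0 hs1
  set Ct : ℝ := (5 : ℝ) ^ (d + 1) * (2 : ℝ) ^ t / (1 - (2 : ℝ) ^ (-t)) with hCt
  have h2t : (2 : ℝ) ^ (-t) < 1 := Real.rpow_lt_one_of_one_lt_of_neg (by norm_num) (by linarith)
  have hCt0 : 0 < Ct := by rw [hCt]; exact div_pos (by positivity) (by linarith)
  refine ⟨(2 : ℝ) ^ (d + 1) * (2 : ℝ) ^ s * C₀ * Ct, δ, by positivity, hδ, ?_⟩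
  intro K hK N _ hN e M _ hM msq hmsq hcap μ ν lam H hH0 hH x x' hxx' w hw0 hw1 hwρ D hD
  have hN1 : (1 : ℝ) ≤ (N : ℝ) := by rw [hN]; exact_mod_cast Nat.one_le_pow K L (by omega)
  have hN0 : 0 < (N : ℝ) := by linarith
  have hNK : ((L : ℝ) ^ K) = (N : ℝ) := by rw [hN, Nat.cast_pow]
  set ρ : ℝ := tdistT (fine N M) x x' with hρdef
  have hρ1 : 1 ≤ ρ := one_le_tdistT_of_ne (fine N M) hxx'
  have hρ0 : 0 < ρ := by linarith
  -- the two kernels as named functions of the source point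
  obtain ⟨DD', hDD'⟩ : ∃ f : Tor (fine N M) → ℝ, ∀ y, f y
      = (N : ℝ) * ((N : ℝ) * (constrainedProp N M (aK a L K) (((N : ℕ) : ℝ) ^ 2) msq (y + unitVec (fine N M) μ) (x' + unitVec (fine N M) ν)
            - constrainedProp N M (aK a L K) (((N : ℕ) : ℝ) ^ 2) msq y (x' + unitVec (fine N M) ν))
          - (N : ℝ) * (constrainedProp N M (aK a L K) (((N : ℕ) : ℝ) ^ 2) msq (y + unitVec (fine N M) μ) x'
            - constrainedProp N M (aK a L K) (((N : ℕ) : ℝ) ^ 2) msq y x')) := ⟨_, fun _ => rfl⟩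
  obtain ⟨DD, hDD⟩ : ∃ f : Tor (fine N M) → ℝ, ∀ y, f y
      = (N : ℝ) * ((N : ℝ) * (constrainedProp N M (aK a L K) (((N : ℕ) : ℝ) ^ 2) msq (y + unitVec (fine N M) μ) (x + unitVec (fine N M) ν)
            - constrainedProp N M (aK a L K) (((N : ℕ) : ℝ) ^ 2) msq y (x + unitVec (fine N M) ν))
          - (N : ℝ) * (constrainedProp N M (aK a L K) (((N : ℕ) : ℝ) ^ 2) msq (y + unitVec (fine N M) μ) x
            - constrainedProp N M (aK a L K) (((N : ℕ) : ℝ) ^ 2) msq y x)) := ⟨_, fun _ => rfl⟩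
  rw [Finset.sum_congr rfl fun y _ => by rw [← hDD' y, ← hDD y]]
  set c : ℝ := ((N : ℝ) ^ (d + 1))⁻¹ with hcdef
  have hc0 : 0 < c := by positivity
  set A : ℝ := (2 : ℝ) ^ (d + 1) * (2 : ℝ) ^ s * C₀ * H * Real.exp (-(δ * D)) * ρ ^ s * (N : ℝ) ^ (-α) with hAdef
  have hA0 : 0 ≤ A := by positivity
  -- termwise: `|c·(DD′ − DD)(y)·w(y)·(λ y − λ x)| ≤ A·[2ρ < |y − x|]·|y − x|^{−t−(d+1)}`
  have hterm : ∀ y, |c * (DD' y - DD y) * w y * (lam y - lam x)|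
      ≤ A * (if 2 * ρ < tdistT (fine N M) x y then tdistT (fine N M) x y ^ (-t - ((d + 1 : ℕ) : ℝ)) else 0) := by
    intro y
    by_cases hwy : w y = 0
    · rw [hwy, mul_zero, zero_mul, abs_zero]
      split_ifs
      · exact mul_nonneg hA0 (Real.rpow_nonneg (tdistT_nonneg _ _ _) _)
      · rw [mul_zero]
    set r : ℝ := tdistT (fine N M) x y with hrdef
    have hr : 2 * ρ < r := by
      by_contra h
      exact hwy (hwρ y (not_lt.mp h))
    rw [if_pos hr]
    have hr0 : 0 < r := by linarith
    have hne : x ≠ y := by intro h; rw [h, tdistT_self] at hrdef; linarith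
    -- `|y − x′| ≥ r − ρ > ρ`
    have hr' : r - ρ ≤ tdistT (fine N M) x' y := by
      have ht := tdistT_triangle (fine N M) x x' y
      rw [← hρdef, ← hrdef] at ht
      linarith
    have hne' : x' ≠ y := by
      intro h; rw [h, tdistT_self] at hr'; linarith
    -- `m ≥ r∕2`
    set m : ℝ := min (tdistT (fine N M) x y) (tdistT (fine N M) x' y) with hmdef
    have hm : r / 2 ≤ m := le_min (by rw [← hrdef]; linarith) (by linarith)
    have hm0 : 0 < m := by linarith
    by_cases hyx : lam y = lam x
    · rw [hyx, sub_self, mul_zero, abs_zero]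
      exact mul_nonneg hA0 (Real.rpow_nonneg hr0.le _)
    -- the kernel's Hölder quotient with decay, unweighted
    have hΔ := HΔ K hK N hN e M hM msq hmsq hcap μ ν x x' y hne hne'
    rw [← hDD' y, ← hDD y, ← hρdef, ← hmdef, hNK] at hΔ
    have hw : 0 < (ρ / (N : ℝ)) ^ s := Real.rpow_pos_of_pos (div_pos hρ0 hN0) s
    have hΔ' : |DD' y - DD y| ≤ (ρ / (N : ℝ)) ^ s * (C₀ * (((N : ℝ) / m) ^ (d + 1) * ((N : ℝ) / m) ^ s)
        * Real.exp (-(δ * min (tdistT M (blockOf N M x) (blockOf N M y)) (tdistT M (blockOf N M x') (blockOf N M y))))) := by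
      have e1 : |DD' y - DD y| = (ρ / (N : ℝ)) ^ s * ((ρ / (N : ℝ)) ^ (-s) * |DD' y - DD y|) := by
        rw [← mul_assoc, Real.rpow_neg (div_pos hρ0 hN0).le, mul_inv_cancel₀ hw.ne', one_mul]
      rw [e1]
      exact mul_le_mul_of_nonneg_left hΔ hw.le
    -- `(N∕m)^{d+1}(N∕m)^s ≤ (2N∕r)^{d+1}(2N∕r)^s`
    have hNm : (N : ℝ) / m ≤ 2 * (N : ℝ) / r := by
      rw [div_le_div_iff₀ hm0 hr0]; nlinarith
    have hpow : ((N : ℝ) / m) ^ (d + 1) * ((N : ℝ) / m) ^ s ≤ (2 * (N : ℝ) / r) ^ (d + 1) * (2 * (N : ℝ) / r) ^ s :=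
      mul_le_mul (pow_le_pow_left₀ (by positivity) hNm _) (Real.rpow_le_rpow (by positivity) hNm hs0.le)
        (Real.rpow_nonneg (by positivity) _) (by positivity)
    -- the decay read at `D`
    have hdec : Real.exp (-(δ * min (tdistT M (blockOf N M x) (blockOf N M y)) (tdistT M (blockOf N M x') (blockOf N M y))))
        ≤ Real.exp (-(δ * D)) := by
      apply Real.exp_le_exp.mpr
      have hDm : D ≤ min (tdistT M (blockOf N M x) (blockOf N M y)) (tdistT M (blockOf N M x') (blockOf N M y)) := by
        by_cases hy0 : lam y = 0
        · have hx0 : lam x ≠ 0 := fun h => hyx (by rw [hy0, h])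
          have hD0 : D ≤ 0 := by have h := (hD x hx0).1; rwa [tdistT_self] at h
          exact hD0.trans (le_min (tdistT_nonneg _ _ _) (tdistT_nonneg _ _ _))
        · exact le_min (hD y hy0).1 (hD y hy0).2
      nlinarith
    have hHy : |lam y - lam x| ≤ H * (r / (N : ℝ)) ^ α := by
      have h := hH y x; rwa [tdistT_symm] at h
    have hscale := far_scale_algebra (s := s) (α := α) hN0 hr0 hρ0 (d + 1)
    calc |c * (DD' y - DD y) * w y * (lam y - lam x)| = c * |DD' y - DD y| * w y * |lam y - lam x| := by
          rw [abs_mul, abs_mul, abs_mul, abs_of_pos hc0, abs_of_nonneg (hw0 y)]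
      _ ≤ c * ((ρ / (N : ℝ)) ^ s * (C₀ * ((2 * (N : ℝ) / r) ^ (d + 1) * (2 * (N : ℝ) / r) ^ s) * Real.exp (-(δ * D))))
          * 1 * (H * (r / (N : ℝ)) ^ α) := by
          refine mul_le_mul (mul_le_mul (mul_le_mul_of_nonneg_left (hΔ'.trans (mul_le_mul_of_nonneg_left
            (mul_le_mul (mul_le_mul_of_nonneg_left hpow hC₀.le) hdec (Real.exp_pos _).le (by positivity)) hw.le)) hc0.le)
            (hw1 y) (hw0 y) (by positivity)) hHy (abs_nonneg _) (by positivity)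
      _ = C₀ * H * Real.exp (-(δ * D)) * (c * (ρ / (N : ℝ)) ^ s * ((2 * (N : ℝ) / r) ^ (d + 1) * (2 * (N : ℝ) / r) ^ s)
          * (r / (N : ℝ)) ^ α) := by ring
      _ = A * r ^ (-t - ((d + 1 : ℕ) : ℝ)) := by
          rw [hscale, hAdef, htdef]; push_cast; ring
  -- sum: the dyadic tail beyond `2ρ`
  have htail := powerSum_tail_le_tdistT (fine N M) x ht0 (S := 2 * ρ) (by linarith)
  have h2ρ : (2 * ρ) ^ (-t) ≤ ρ ^ (-t) := Real.rpow_le_rpow_of_nonpos hρ0 (by linarith) (by linarith)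
  have hρN : ρ ^ s * (N : ℝ) ^ (-α) * ρ ^ (-t) = (ρ / (N : ℝ)) ^ α := by
    rw [htdef, Real.div_rpow hρ0.le hN0.le, Real.rpow_neg hN0.le, mul_assoc, mul_comm ((N : ℝ) ^ α)⁻¹, ← mul_assoc,
      ← Real.rpow_add hρ0, show s + -(s - α) = α by ring, div_eq_mul_inv]
  calc |∑ y, c * (DD' y - DD y) * w y * (lam y - lam x)| ≤ ∑ y, |c * (DD' y - DD y) * w y * (lam y - lam x)| :=
        Finset.abs_sum_le_sum_abs _ _
    _ ≤ ∑ y, A * (if 2 * ρ < tdistT (fine N M) x y then tdistT (fine N M) x y ^ (-t - ((d + 1 : ℕ) : ℝ)) else 0) :=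
        Finset.sum_le_sum fun y _ => hterm y
    _ = A * ∑ y ∈ Finset.univ.filter (fun y => 2 * ρ < tdistT (fine N M) x y), tdistT (fine N M) x y ^ (-t - ((d + 1 : ℕ) : ℝ)) := by
        rw [← Finset.mul_sum, Finset.sum_filter]
    _ ≤ A * (Ct * (2 * ρ) ^ (-t)) := mul_le_mul_of_nonneg_left htail hA0
    _ ≤ A * (Ct * ρ ^ (-t)) := mul_le_mul_of_nonneg_left (mul_le_mul_of_nonneg_left h2ρ hCt0.le) hA0
    _ = (2 : ℝ) ^ (d + 1) * (2 : ℝ) ^ s * C₀ * Ct * H * (ρ ^ s * (N : ℝ) ^ (-α) * ρ ^ (-t)) * Real.exp (-(δ * D)) := by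
        rw [hAdef]; ring
    _ = (2 : ℝ) ^ (d + 1) * (2 : ℝ) ^ s * C₀ * Ct * H * (ρ / (N : ℝ)) ^ α * Real.exp (-(δ * D)) := by rw [hρN]

/-! ## §2 (3.45) at `U ≡ 1` for King's full `A = 0` propagator: `∇A₀⁻¹∇*` maps `C^α → C^α` -/

/-- ★★★ **[B9] (3.45) AT `U ≡ 1` — THE HÖLDER NORM OF THE MIXED OBJECT `∇_{μ′}A₀⁻¹∇*_μλ` FOR KING'S FULL `A = 0` FLUCTUATION PROPAGATOR.**  For `d ≥ 1`, odd
`L ≥ 3`, `a > 0`, a mass cap `m₀² ≥ 0` and `0 < α < 1` there are `C, δ > 0` (functions of `d, L, a, m₀², α`) such that for EVERY `K ≥ 1` (spelling `N = L^K`),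
cube `M_μ = 2L^e`, mass `0 < m² ≤ m₀²`, directions `μ, μ′`, every source `λ` on the fine torus with `|λ(y) − λ(y′)| ≤ H·(|y − y′|∕N)^α` (`H ≥ 0`, α-HÖLDER in
unit coordinates), all fine points `x, x′` and every `D` with `D ≤ |B(x) − B(y)|_M` and `D ≤ |B(x′) − B(y)|_M` whenever `λ(y) ≠ 0`:
`(|x − x′|∕N)^{−α}·|F(x′) − F(x)| ≤ C·H·exp(−δD)`, `F(x) = N·((A₀⁻¹∇*_μλ)(x + e_μ′) − (A₀⁻¹∇*_μλ)(x))`, `(∇*_μλ)(y) = N(λ(y − e_μ) − λ(y))`,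
`A₀⁻¹ = (fineOp N M a_K N² m²)⁻¹` — the printed «`‖ζ∇_UG(U)∇*_Uλ‖_α ≤ B′₀(ε, α)(…)e^{−δ₀d(y,y′)}(‖λ‖_{α+ε} + |λ|)`» at `U ≡ 1` (here with NO `ε`-loss: the
operator `∇A₀⁻¹∇*` is bounded `C^α → C^α`), uniformly in `K`, the volume and the mass.  Proof: V-b's kernel sum and cancellation, the four-term split (Ψ-b), the near
field (Ψ-b, radii `7ρ`, `6ρ`), the far field (§1), the boundary term (Ψ-b); `x = x′` is the trivial case `0^{−α} = 0`.
[cite: Balaban1985BackgroundPropagators, Thm 3.1 (3.45) p.398, (3.40) p.397; King1986, (2.13) p.653, Prop. 3.7 (3.63)/(3.65) p.663; Balaban1983RegularityDecay, Theorem (1.10) p.573] -/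
theorem fullPropMixedOp_holderNorm_le (hd : 1 ≤ d) (hLodd : Odd L) (hL : 2 ≤ L) {a : ℝ} (ha : 0 < a) {m0sq : ℝ} (hm0 : 0 ≤ m0sq)
    {α : ℝ} (hα0 : 0 < α) (hα1 : α < 1) :
    ∃ C δ : ℝ, 0 < C ∧ 0 < δ ∧ ∀ (K : ℕ), 1 ≤ K → ∀ (N : ℕ) [NeZero N], N = L ^ K →
      ∀ (e : ℕ) (M : Fin (d + 1) → ℕ) [∀ μ, NeZero (M μ)], (∀ μ, M μ = 2 * L ^ e) →
      ∀ (msq : ℝ), 0 < msq → msq ≤ m0sq → ∀ (μ μ' : Fin (d + 1)) (lam : Tor (fine N M) → ℝ) (H : ℝ),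
        0 ≤ H → (∀ y y', |lam y - lam y'| ≤ H * (tdistT (fine N M) y y' / (N : ℝ)) ^ α) →
        ∀ (x x' : Tor (fine N M)) (D : ℝ),
        (∀ y, lam y ≠ 0 → D ≤ tdistT M (blockOf N M x) (blockOf N M y)) →
        (∀ y, lam y ≠ 0 → D ≤ tdistT M (blockOf N M x') (blockOf N M y)) →
        (tdistT (fine N M) x x' / (N : ℝ)) ^ (-α) *
          |((N : ℝ) * (((fineOp N M (aK a L K) (((N : ℕ) : ℝ) ^ 2) msq)⁻¹
                *ᵥ (fun y => (N : ℝ) * (lam (y - unitVec (fine N M) μ) - lam y))) (x' + unitVec (fine N M) μ')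
              - ((fineOp N M (aK a L K) (((N : ℕ) : ℝ) ^ 2) msq)⁻¹
                *ᵥ (fun y => (N : ℝ) * (lam (y - unitVec (fine N M) μ) - lam y))) x'))
           - ((N : ℝ) * (((fineOp N M (aK a L K) (((N : ℕ) : ℝ) ^ 2) msq)⁻¹
                *ᵥ (fun y => (N : ℝ) * (lam (y - unitVec (fine N M) μ) - lam y))) (x + unitVec (fine N M) μ')
              - ((fineOp N M (aK a L K) (((N : ℕ) : ℝ) ^ 2) msq)⁻¹
                *ᵥ (fun y => (N : ℝ) * (lam (y - unitVec (fine N M) μ) - lam y))) x))|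
          ≤ C * H * Real.exp (-(δ * D)) := by
  obtain ⟨C₁, δ₁, hC₁, hδ₁, HN⟩ := mixedKernel_nearField_le (d := d) L hLodd hL ha hm0 hα0 hα1
  obtain ⟨C₂, δ₂, hC₂, hδ₂, HF⟩ := mixedKernel_farField_le (d := d) L hLodd hL ha hm0 hα0 hα1
  obtain ⟨C₃, hC₃, HB⟩ := mixedKernel_cutoffSum_le (d := d) L hd hLodd hL ha hm0
  set δ : ℝ := min δ₁ δ₂ with hδdef
  have hδ0 : 0 < δ := lt_min hδ₁ hδ₂
  refine ⟨13 * C₁ + C₂ + C₃, δ, by positivity, hδ0, ?_⟩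
  intro K hK N _ hN e M _ hM msq hmsq hcap μ μ' lam H hH0 hH x x' D hDx hDx'
  have hN1 : (1 : ℝ) ≤ (N : ℝ) := by rw [hN]; exact_mod_cast Nat.one_le_pow K L (by omega)
  have hN0 : 0 < (N : ℝ) := by linarith
  -- the trivial case `x = x′`
  by_cases hxx' : x = x'
  · rw [hxx', tdistT_self, zero_div, Real.zero_rpow (by linarith : -α ≠ 0), zero_mul]
    positivity
  set ρ : ℝ := tdistT (fine N M) x x' with hρdef
  have hρ1 : 1 ≤ ρ := one_le_tdistT_of_ne (fine N M) hxx'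
  have hρ0 : 0 < ρ := by linarith
  have hρN : 0 < ρ / (N : ℝ) := div_pos hρ0 hN0
  -- `D₊ = max D 0` still satisfies the support hypotheses, and `e^{−δᵢD₊} ≤ e^{−δD}`
  set Dp : ℝ := max D 0 with hDp
  have hDp0 : 0 ≤ Dp := le_max_right _ _
  have hDpx : ∀ y, lam y ≠ 0 → Dp ≤ tdistT M (blockOf N M x) (blockOf N M y) :=
    fun y hy => max_le (hDx y hy) (tdistT_nonneg _ _ _)
  have hDpx' : ∀ y, lam y ≠ 0 → Dp ≤ tdistT M (blockOf N M x') (blockOf N M y) :=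
    fun y hy => max_le (hDx' y hy) (tdistT_nonneg _ _ _)
  have hE1 : Real.exp (-(δ₁ * Dp)) ≤ Real.exp (-(δ * D)) := by
    apply Real.exp_le_exp.mpr
    have h1 : δ * D ≤ δ * Dp := mul_le_mul_of_nonneg_left (le_max_left _ _) hδ0.le
    nlinarith [min_le_left δ₁ δ₂]
  have hE2 : Real.exp (-(δ₂ * Dp)) ≤ Real.exp (-(δ * D)) := by
    apply Real.exp_le_exp.mpr
    have h1 : δ * D ≤ δ * Dp := mul_le_mul_of_nonneg_left (le_max_left _ _) hδ0.le
    nlinarith [min_le_right δ₁ δ₂]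
  -- the kernel sums and the two kernels as named functions
  rw [inv_deriv_adjDeriv_eq_sum, inv_deriv_adjDeriv_eq_sum]
  obtain ⟨DD', hDD'⟩ : ∃ f : Tor (fine N M) → ℝ, ∀ y, f y
      = (N : ℝ) * ((N : ℝ) * (constrainedProp N M (aK a L K) (((N : ℕ) : ℝ) ^ 2) msq (y + unitVec (fine N M) μ) (x' + unitVec (fine N M) μ')
            - constrainedProp N M (aK a L K) (((N : ℕ) : ℝ) ^ 2) msq y (x' + unitVec (fine N M) μ'))
          - (N : ℝ) * (constrainedProp N M (aK a L K) (((N : ℕ) : ℝ) ^ 2) msq (y + unitVec (fine N M) μ) x'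
            - constrainedProp N M (aK a L K) (((N : ℕ) : ℝ) ^ 2) msq y x')) := ⟨_, fun _ => rfl⟩
  obtain ⟨DD, hDD⟩ : ∃ f : Tor (fine N M) → ℝ, ∀ y, f y
      = (N : ℝ) * ((N : ℝ) * (constrainedProp N M (aK a L K) (((N : ℕ) : ℝ) ^ 2) msq (y + unitVec (fine N M) μ) (x + unitVec (fine N M) μ')
            - constrainedProp N M (aK a L K) (((N : ℕ) : ℝ) ^ 2) msq y (x + unitVec (fine N M) μ'))
          - (N : ℝ) * (constrainedProp N M (aK a L K) (((N : ℕ) : ℝ) ^ 2) msq (y + unitVec (fine N M) μ) x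
            - constrainedProp N M (aK a L K) (((N : ℕ) : ℝ) ^ 2) msq y x)) := ⟨_, fun _ => rfl⟩
  simp only [← hDD', ← hDD]
  set c : ℝ := ((N : ℝ) ^ (d + 1))⁻¹ with hcdef
  have hsum : ∑ y, DD y = 0 := by
    rw [Finset.sum_congr rfl fun y _ => hDD y]; exact sum_mixedKernel_eq_zero N M (aK a L K) (((N : ℕ) : ℝ) ^ 2) msq x μ μ'
  have hsum' : ∑ y, DD' y = 0 := by
    rw [Finset.sum_congr rfl fun y _ => hDD' y]; exact sum_mixedKernel_eq_zero N M (aK a L K) (((N : ℕ) : ℝ) ^ 2) msq x' μ μ'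
  -- the cut-off around `x` at radius `R = 2ρ + 1`
  set R : ℝ := 2 * ρ + 1 with hRdef
  have hR0 : 0 < R := by positivity
  obtain ⟨χ, hχ⟩ : ∃ f : Tor (fine N M) → ℝ, ∀ y, f y = max 0 (min 1 ((2 * R - tdistT (fine N M) x y) / R)) := ⟨_, fun _ => rfl⟩
  have hχ0 : ∀ y, 0 ≤ χ y := fun y => by rw [hχ]; exact radialCutoff_nonneg R _
  have hχ1 : ∀ y, χ y ≤ 1 := fun y => by rw [hχ]; exact radialCutoff_le_one R _
  -- the split
  rw [mixedKernel_holder_split c (lam x) (lam x') DD DD' χ lam hsum hsum']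
  -- NEAR at `x′` (radius `7ρ`) and at `x` (radius `6ρ`)
  have hN1' : |∑ y, c * DD' y * χ y * (lam y - lam x')| ≤ C₁ * H * (7 * ρ / (N : ℝ)) ^ α * Real.exp (-(δ₁ * Dp)) := by
    have h := HN K hK N hN e M hM msq hmsq hcap μ μ' lam H hH0 hH x' (7 * ρ) (by linarith) χ hχ0 hχ1 ?_ Dp hDpx'
    · simpa only [hDD'] using h
    · intro y hy
      rw [hχ]
      refine radialCutoff_eq_zero hR0 ?_
      have ht := tdistT_triangle (fine N M) x' x y
      rw [tdistT_symm (fine N M) x' x, ← hρdef] at ht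
      rw [hRdef]; linarith
  have hN2' : |∑ y, c * DD y * χ y * (lam y - lam x)| ≤ C₁ * H * (6 * ρ / (N : ℝ)) ^ α * Real.exp (-(δ₁ * Dp)) := by
    have h := HN K hK N hN e M hM msq hmsq hcap μ μ' lam H hH0 hH x (6 * ρ) (by linarith) χ hχ0 hχ1 ?_ Dp hDpx
    · simpa only [hDD] using h
    · intro y hy
      rw [hχ]
      exact radialCutoff_eq_zero hR0 (by rw [hRdef]; linarith)
  -- FAR with the weight `1 − χ`
  have hF' : |∑ y, c * (DD' y - DD y) * (1 - χ y) * (lam y - lam x)| ≤ C₂ * H * (ρ / (N : ℝ)) ^ α * Real.exp (-(δ₂ * Dp)) := by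
    have h := HF K hK N hN e M hM msq hmsq hcap μ μ' lam H hH0 hH x x' hxx' (fun y => 1 - χ y)
      (fun y => by have := hχ1 y; linarith) (fun y => by have := hχ0 y; linarith) ?_ Dp (fun y hy => ⟨hDpx y hy, hDpx' y hy⟩)
    · simpa only [hDD', hDD] using h
    · intro y hy
      have : χ y = 1 := by rw [hχ]; exact radialCutoff_eq_one hR0 (by rw [hRdef]; linarith)
      rw [this, sub_self]
  -- BOUNDARY
  have hB' : |(lam x' - lam x) * ∑ y, c * DD' y * χ y| ≤ C₃ * H * (ρ / (N : ℝ)) ^ α * Real.exp (-(δ * D)) := by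
    by_cases hxe : lam x' = lam x
    · rw [hxe, sub_self, zero_mul, abs_zero]; positivity
    have hcut := HB K hK N hN e M hM msq hmsq hcap μ μ' x x' hxx'
    have hcut' : |∑ y, c * DD' y * χ y| ≤ C₃ := by
      have e : ∀ y, c * DD' y * χ y = c * DD' y * max 0 (min 1 ((2 * (2 * tdistT (fine N M) x x' + 1) - tdistT (fine N M) x y)
          / (2 * tdistT (fine N M) x x' + 1))) := fun y => by rw [hχ]
      rw [Finset.sum_congr rfl fun y _ => e y]
      simpa only [hDD'] using hcut
    have hHx : |lam x' - lam x| ≤ H * (ρ / (N : ℝ)) ^ α := by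
      have h := hH x' x; rwa [tdistT_symm] at h
    -- one of `λ(x), λ(x′)` is nonzero, so `D ≤ 0`
    have hD0 : D ≤ 0 := by
      by_cases hx0 : lam x = 0
      · have hx'0 : lam x' ≠ 0 := fun h => hxe (by rw [h, hx0])
        have h := hDx' x' hx'0; rwa [tdistT_self] at h
      · have h := hDx x hx0; rwa [tdistT_self] at h
    have hE : (1 : ℝ) ≤ Real.exp (-(δ * D)) := by
      rw [← Real.exp_zero]; exact Real.exp_le_exp.mpr (by nlinarith)
    calc |(lam x' - lam x) * ∑ y, c * DD' y * χ y| = |lam x' - lam x| * |∑ y, c * DD' y * χ y| := abs_mul _ _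
      _ ≤ H * (ρ / (N : ℝ)) ^ α * C₃ := mul_le_mul hHx hcut' (abs_nonneg _) (by positivity)
      _ = C₃ * H * (ρ / (N : ℝ)) ^ α * 1 := by ring
      _ ≤ C₃ * H * (ρ / (N : ℝ)) ^ α * Real.exp (-(δ * D)) := mul_le_mul_of_nonneg_left hE (by positivity)
  -- the radii: `(7ρ∕N)^α ≤ 7(ρ∕N)^α`, `(6ρ∕N)^α ≤ 6(ρ∕N)^α`
  have hrad : ∀ k : ℝ, 1 ≤ k → (k * ρ / (N : ℝ)) ^ α ≤ k * (ρ / (N : ℝ)) ^ α := by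
    intro k hk
    rw [mul_div_assoc, Real.mul_rpow (by linarith) hρN.le]
    refine mul_le_mul_of_nonneg_right ?_ (Real.rpow_nonneg hρN.le _)
    calc k ^ α ≤ k ^ (1 : ℝ) := Real.rpow_le_rpow_of_exponent_le hk hα1.le
      _ = k := Real.rpow_one _
  have h7 := hrad 7 (by norm_num)
  have h6 := hrad 6 (by norm_num)
  -- assemble `|ΔF| ≤ (13C₁ + C₂ + C₃)·H·(ρ∕N)^α·e^{−δD}`
  have hmain : |∑ y, c * DD' y * χ y * (lam y - lam x') - ∑ y, c * DD y * χ y * (lam y - lam x)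
        + ∑ y, c * (DD' y - DD y) * (1 - χ y) * (lam y - lam x) + (lam x' - lam x) * ∑ y, c * DD' y * χ y|
      ≤ (13 * C₁ + C₂ + C₃) * H * (ρ / (N : ℝ)) ^ α * Real.exp (-(δ * D)) := by
    have hw : 0 ≤ H * (ρ / (N : ℝ)) ^ α := by positivity
    calc _ ≤ |∑ y, c * DD' y * χ y * (lam y - lam x')| + |∑ y, c * DD y * χ y * (lam y - lam x)|
          + |∑ y, c * (DD' y - DD y) * (1 - χ y) * (lam y - lam x)| + |(lam x' - lam x) * ∑ y, c * DD' y * χ y| := by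
          refine (abs_add_le _ _).trans (add_le_add ((abs_add_le _ _).trans (add_le_add (abs_sub _ _) le_rfl)) le_rfl)
      _ ≤ C₁ * H * (7 * (ρ / (N : ℝ)) ^ α) * Real.exp (-(δ * D)) + C₁ * H * (6 * (ρ / (N : ℝ)) ^ α) * Real.exp (-(δ * D))
          + C₂ * H * (ρ / (N : ℝ)) ^ α * Real.exp (-(δ * D)) + C₃ * H * (ρ / (N : ℝ)) ^ α * Real.exp (-(δ * D)) := by
          refine add_le_add (add_le_add (add_le_add (hN1'.trans ?_) (hN2'.trans ?_)) (hF'.trans ?_)) hB'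
          · exact mul_le_mul (mul_le_mul_of_nonneg_left h7 (by positivity)) hE1 (Real.exp_pos _).le (by positivity)
          · exact mul_le_mul (mul_le_mul_of_nonneg_left h6 (by positivity)) hE1 (Real.exp_pos _).le (by positivity)
          · exact mul_le_mul_of_nonneg_left hE2 (by positivity)
      _ = (13 * C₁ + C₂ + C₃) * H * (ρ / (N : ℝ)) ^ α * Real.exp (-(δ * D)) := by ring
  -- multiply by `(ρ∕N)^{−α}`
  have hw0 : 0 ≤ (ρ / (N : ℝ)) ^ (-α) := Real.rpow_nonneg hρN.le _
  have hcancel : (ρ / (N : ℝ)) ^ (-α) * (ρ / (N : ℝ)) ^ α = 1 := by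
    rw [Real.rpow_neg hρN.le, inv_mul_cancel₀ (Real.rpow_pos_of_pos hρN α).ne']
  calc _ ≤ (ρ / (N : ℝ)) ^ (-α) * ((13 * C₁ + C₂ + C₃) * H * (ρ / (N : ℝ)) ^ α * Real.exp (-(δ * D))) :=
        mul_le_mul_of_nonneg_left hmain hw0
    _ = (13 * C₁ + C₂ + C₃) * H * Real.exp (-(δ * D)) * ((ρ / (N : ℝ)) ^ (-α) * (ρ / (N : ℝ)) ^ α) := by ring
    _ = (13 * C₁ + C₂ + C₃) * H * Real.exp (-(δ * D)) := by rw [hcancel, mul_one]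

end Summit.QuantumFields.YangMills.BalabanUVNodes.N15KingModelRung.Curved
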